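/-
Copyright (c) 2026 the pub-hodgecm-mathlib formalisation cell (harness21).  Prover seat hodgecm-mathlib-LH4-p08 (g2), req620 Track A «(D-RAM) FOUR-FRAME» squad, unit U3_Laws (iii),
MS ROAD STAGE B (Stage B lead LH4-p10 (g2), MS ledger LH4-p11 (g0); dealer LH4-plan (g11)): brick B5 (iv) «GLUED PARAMETER BOX COUNT» of `SPEC-StageB.v2-B5split.LH4p10g2.md`
(a6778cd80cb70dec), sub-brick (iv-c) «F-RATIONAL CLASS REPRESENTATIVES» (route LH4-p08 (g2) 2026-09-03T23:56Z).  2026-09-04.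
-/
import Literature.NumberTheory.LocalFields.RamifiedQuadraticResidueCountsUnits   -- ★ p855694 B1 (F0P3-p01): (C4) `relIndex_fixedUnitLevel_eq`
import Literature.NumberTheory.Automorphic.UnitaryLatticeTreeTubeCoordinate           -- ★ `UnitaryLatticeTree.v_pow_eq_exp_neg` (`|ϖ|^n = exp(−n)`)
import Mathlib.GroupTheory.Complement
import HarnessLib

/-!
# Crux `H413`, line LH4 «(D-RAM) FOUR-FRAME» road — unit U3_Laws (iii), MS ROAD STAGE B, brick B5 (iv), sub-brick (iv-c): a system of REPRESENTATIVES of the `σ`-FIXED elements of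
# valuation `|ϖ|^{2t}` modulo `𝔭^{ρ+2t}`, of cardinality `(q − 1)·q^{⌈ρ∕2⌉ − 1}` (the number of `F`-rational classes of the glued invariant `κ`)

Cell `hodgecm-mathlib` (D-0151), FLOOR 0, crux item H413 = `stmt-HodgeConjecture-24833`, route of record `HCCMUnconditional`; squad F0∕P3c∕LH4 (req620).  THEOREMS ONLY (no `def`,
no instance, no notation, no `sorry`, default heartbeats); lane `--supports stmt-HodgeConjecture-24833 --as helper` (count-neutral).  Third sub-brick of B5 (iv) (LH4-p10 (g2) SPEC
v2-B5split §B5(iv)) on the ORBIT–STABILISER route: the dualisable glued lattices form one `𝒯`-orbit per `F`-rational class of `κ = y″∕(xζ)` mod `𝔭^{ρ+2t}` (★ (iv-a)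
`F0P3cDyRamDiagonalGluedTorusOrbits`); this file counts the classes by exhibiting an irredundant complete set of `σ`-fixed representatives.

THE MATHEMATICS.  `π₀ := ϖ·σϖ` is `σ`-fixed of valuation `|ϖ|²`; `f ↦ f∕π₀^t` matches the fixed elements of valuation `|ϖ|^{2t}` with the fixed UNITS `U_F`, and the classes modulo
`𝔭^{ρ+2t}` with the cosets of `U_{F,ρ} = U_F ∩ (1 + 𝔭^ρ)`; a left transversal `S` of `U_{F,ρ}` in `U_F` (Mathlib `Subgroup.exists_isComplement_left`) has
`#S = [U_F : U_{F,ρ}] = (q − 1)·q^{⌈ρ∕2⌉ − 1}` (★ B1 (C4) `relIndex_fixedUnitLevel_eq`), and `R := π₀^t · S` is the representative system.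

WHAT IS PROVED (ramified quadratic datum letters `hσ hvσ hfix hϖ hd`, `[Finite 𝓀[K]]`, `q = Nat.card 𝓀[K]`, `ρ ≥ 1`, any `t`):
* §1 `map_mul_map_eq` ∕ `v_mul_map_pow` (`π₀^t` is fixed of valuation `|ϖ|^{2t}`).
* §2 **`exists_fixed_class_representatives`** — `∃ R : Set K`, FINITE, `R.ncard = (q − 1)·q^((ρ + 1)∕2 − 1)`, every `g ∈ R` is `σ`-fixed with `|g| = |ϖ|^{2t}` (R1), every `σ`-fixed `f`
  with `|f| = |ϖ|^{2t}` has some `g ∈ R` with `|f − g| ≤ |ϖ|^{ρ+2t}` (R2, complete), and `g, g′ ∈ R` with `|g − g′| ≤ |ϖ|^{ρ+2t}` are equal (R3, irredundant).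
HONEST LABEL.  Count-neutral; nothing printed is asserted; the census laws stay PROVER TARGETS; `HC_CM` is proved only modulo the 7 printed citations (2 remaining named inputs: hLiu418 =
`stmt-HodgeConjecture-24832`, h413 = `stmt-HodgeConjecture-24833`) until rung 0 closes.

## References
* [Serre1979] J.-P. Serre, *Local Fields*, GTM 67 (1979), Ch. IV §2 Prop. 6 (`U∕Uⁿ` filtration counts), Ch. II §2 Prop. 3, Cor. 2–3 pp. 28–29.
* [Kottwitz1986BaseChangeUnits] R. Kottwitz, *Base change for unit elements of Hecke algebras*, Compositio Math. 60 (1986), §1 pp. 240–241 (lattice counts via torus orbits).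
-/

set_option autoImplicit false

noncomputable section

namespace Summit.HodgeConjecture.HodgeConjecture.Cruxes.H413.F0P3cDyRamDiagonalGluedClassRepresentatives

open WithZero Subgroup
open Literature.NumberTheory.LocalFields.WildQuadraticDatum
open Literature.NumberTheory.Automorphic.UnitaryLatticeTree (v_pow_eq_exp_neg)
open scoped Valued

variable {K : Type*} [Field K] [Valued K ℤᵐ⁰]

/-! ## §1 Small valuation facts -/

omit [Valued K ℤᵐ⁰] in
/-- `σ(ϖσϖ) = ϖσϖ` for an involution `σ`. [cite: Serre1979, Ch. IV §2 Prop. 6] -/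
theorem map_mul_map_eq {σ : K →+* K} (hσ : ∀ x, σ (σ x) = x) (ϖ : K) : σ (ϖ * σ ϖ) = ϖ * σ ϖ := by
  rw [map_mul, hσ, mul_comm]

/-- `|(ϖσϖ)^t| = |ϖ|^{2t}` when `v ∘ σ = v`. [cite: Serre1979, Ch. IV §2 Prop. 6] -/
theorem v_mul_map_pow {σ : K →+* K} (hvσ : ∀ a, Valued.v (σ a) = Valued.v a) (ϖ : K) (t : ℕ) : Valued.v ((ϖ * σ ϖ) ^ t) = Valued.v ϖ ^ (2 * t) := by
  rw [map_pow, map_mul, hvσ, ← sq, ← pow_mul]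

/-! ## §2 The representative system -/

/-- **REPRESENTATIVES OF THE `σ`-FIXED ELEMENTS OF VALUATION `|ϖ|^{2t}` MODULO `𝔭^{ρ+2t}`**, `(q − 1)·q^{⌈ρ∕2⌉ − 1}` of them (`ρ ≥ 1`): a finite `R ⊆ K` with (R1) every `g ∈ R`
fixed of valuation `|ϖ|^{2t}`, (R2) every fixed `f` of valuation `|ϖ|^{2t}` within `𝔭^{ρ+2t}` of some `g ∈ R`, (R3) distinct members of `R` at distance `> |ϖ|^{ρ+2t}`.
(`R = π₀^t · S`, `S` a left transversal of `U_{F,ρ}` in `U_F`; `#S` by ★ B1 (C4).) [cite: Serre1979, Ch. IV §2 Prop. 6] [cite: Kottwitz1986BaseChangeUnits, §1 pp. 240–241] -/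
theorem exists_fixed_class_representatives {σ : K →+* K} {ϖ : K} {d : ℕ} (hσ : ∀ x, σ (σ x) = x) (hvσ : ∀ a, Valued.v (σ a) = Valued.v a)
    (hfix : ∀ x : K, σ x = x → x ≠ 0 → ∃ n : ℤ, Valued.v x = exp (2 * n)) (hϖ : Valued.v ϖ = exp (-1 : ℤ))
    (hd : Valued.v (ϖ - σ ϖ) = Valued.v ϖ ^ d) [Finite 𝓀[K]] (ρ t : ℕ) (hρ : 1 ≤ ρ) :
    ∃ R : Set K, R.Finite ∧ R.ncard = (Nat.card 𝓀[K] - 1) * Nat.card 𝓀[K] ^ ((ρ + 1) / 2 - 1) ∧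
      (∀ g ∈ R, σ g = g ∧ Valued.v g = Valued.v ϖ ^ (2 * t)) ∧
      (∀ f : K, σ f = f → Valued.v f = Valued.v ϖ ^ (2 * t) → ∃ g ∈ R, Valued.v (f - g) ≤ Valued.v ϖ ^ (ρ + 2 * t)) ∧
      (∀ g ∈ R, ∀ g' ∈ R, Valued.v (g - g') ≤ Valued.v ϖ ^ (ρ + 2 * t) → g = g') := by
  classical
  have hϖ0 : ϖ ≠ 0 := fun h0 => by rw [h0, map_zero] at hϖ; exact WithZero.coe_ne_zero hϖ.symm
  have hvϖ0 : Valued.v ϖ ≠ 0 := (Valuation.ne_zero_iff _).2 hϖ0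
  -- the fixed element `c := π₀^t`
  set c : K := (ϖ * σ ϖ) ^ t with hc
  have hσc : σ c = c := by rw [hc, map_pow, map_mul_map_eq hσ]
  have hvc : Valued.v c = Valued.v ϖ ^ (2 * t) := v_mul_map_pow hvσ ϖ t
  have hc0 : c ≠ 0 := fun h0 => by rw [h0, map_zero] at hvc; exact pow_ne_zero _ hvϖ0 hvc.symm
  -- the fixed units `U_F` and their level-`ρ` subgroup, as subgroups of `Kˣ`
  let U : Subgroup Kˣ :=
    { carrier := {u | σ (u : K) = u ∧ Valued.v (u : K) = 1}
      mul_mem' := fun {a b} ha hb => ⟨by rw [Units.val_mul, map_mul, ha.1, hb.1], by rw [Units.val_mul, map_mul, ha.2, hb.2, mul_one]⟩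
      one_mem' := ⟨by rw [Units.val_one, map_one], by rw [Units.val_one, map_one]⟩
      inv_mem' := fun {a} ha => ⟨by rw [Units.val_inv_eq_inv_val, map_inv₀, ha.1], by rw [Units.val_inv_eq_inv_val, map_inv₀, ha.2, inv_one]⟩ }
  have hU : ∀ u : Kˣ, u ∈ U ↔ σ u = u ∧ Valued.v (u : K) = 1 := fun u => Iff.rfl
  let Uρ : Subgroup Kˣ :=
    { carrier := {u | (σ (u : K) = u ∧ Valued.v (u : K) = 1) ∧ Valued.v ((u : K) - 1) ≤ exp (-(ρ : ℤ))}
      mul_mem' := fun {a b} ha hb => by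
        refine ⟨⟨by rw [Units.val_mul, map_mul, ha.1.1, hb.1.1], by rw [Units.val_mul, map_mul, ha.1.2, hb.1.2, mul_one]⟩, ?_⟩
        have h : (a : K) * b - 1 = a * ((b : K) - 1) + ((a : K) - 1) := by ring
        rw [Units.val_mul, h]
        refine Valuation.map_add_le _ ?_ ha.2
        rw [map_mul, ha.1.2, one_mul]; exact hb.2
      one_mem' := ⟨⟨by rw [Units.val_one, map_one], by rw [Units.val_one, map_one]⟩, by rw [Units.val_one, sub_self, map_zero]; exact zero_le⟩
      inv_mem' := fun {a} ha => by
        refine ⟨⟨by rw [Units.val_inv_eq_inv_val, map_inv₀, ha.1.1], by rw [Units.val_inv_eq_inv_val, map_inv₀, ha.1.2, inv_one]⟩, ?_⟩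
        have h : ((a⁻¹ : Kˣ) : K) - 1 = (a⁻¹ : Kˣ) * (1 - (a : K)) := by
          rw [mul_sub, mul_one, ← Units.val_mul, inv_mul_cancel, Units.val_one]
        rw [h, map_mul, Units.val_inv_eq_inv_val, map_inv₀, ha.1.2, inv_one, one_mul, Valuation.map_sub_swap]
        exact ha.2 }
  have hUρ : ∀ u : Kˣ, u ∈ Uρ ↔ (σ u = u ∧ Valued.v (u : K) = 1) ∧ Valued.v ((u : K) - 1) ≤ exp (-(ρ : ℤ)) := fun u => Iff.rfl
  have hle : Uρ ≤ U := fun u hu => hu.1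
  -- its index (★ B1 (C4))
  have hidx : Uρ.relIndex U = (Nat.card 𝓀[K] - 1) * Nat.card 𝓀[K] ^ ((ρ + 1) / 2 - 1) :=
    relIndex_fixedUnitLevel_eq hσ hvσ hfix hϖ hd hU hρ hUρ
  -- a left transversal of `Uρ` in `U`
  obtain ⟨S, hS, -⟩ := (Uρ.subgroupOf U).exists_isComplement_left 1
  have hcardS : Nat.card S = (Nat.card 𝓀[K] - 1) * Nat.card 𝓀[K] ^ ((ρ + 1) / 2 - 1) := by
    rw [hS.card_left]; exact hidx
  -- the representatives `R := c · S`
  let φ : ↥U → K := fun s => c * ((s : Kˣ) : K)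
  have hφ : Function.Injective φ := fun s s' h => by
    apply Subtype.ext; apply Units.ext
    exact mul_left_cancel₀ hc0 h
  refine ⟨φ '' S, ?_, ?_, ?_, ?_, ?_⟩
  · -- finite
    have hq : (Nat.card 𝓀[K] - 1) * Nat.card 𝓀[K] ^ ((ρ + 1) / 2 - 1) ≠ 0 := by
      have h1 : 1 < Nat.card 𝓀[K] := Finite.one_lt_card
      exact mul_ne_zero (by omega) (pow_ne_zero _ (by omega))
    haveI : Finite S := Nat.finite_of_card_ne_zero (by rw [hcardS]; exact hq)
    exact (S.toFinite).image φ
  · -- cardinality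
    rw [Set.ncard_image_of_injective _ hφ, ← Nat.card_coe_set_eq, hcardS]
  · -- (R1)
    rintro g ⟨s, hs, rfl⟩
    exact ⟨by rw [map_mul, hσc, s.2.1], by rw [map_mul, hvc, s.2.2, mul_one]⟩
  · -- (R2) completeness
    intro f hσf hvf
    have hf0 : f ≠ 0 := fun h0 => by rw [h0, map_zero] at hvf; exact pow_ne_zero _ hvϖ0 hvf.symm
    have hw1 : Valued.v (f / c) = 1 := by rw [map_div₀, hvf, hvc, div_self (pow_ne_zero _ hvϖ0)]
    let w : ↥U := ⟨Units.mk0 (f / c) (div_ne_zero hf0 hc0), ⟨by rw [Units.val_mk0, map_div₀, hσf, hσc], by rw [Units.val_mk0]; exact hw1⟩⟩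
    obtain ⟨r, hr, -⟩ := (Subgroup.isComplement_iff_existsUnique_inv_mul_mem.1 hS) w
    have hr' := (Subgroup.mem_subgroupOf.1 hr).2
    have hval : ((((r : ↥U)⁻¹ * w : ↥U) : Kˣ) : K) = ((((r : ↥U) : Kˣ) : K))⁻¹ * (f / c) := by simp [w]
    rw [hval] at hr'
    refine ⟨φ r, ⟨r, r.2, rfl⟩, ?_⟩
    have hvr : Valued.v ((((r : ↥U) : Kˣ) : K)) = 1 := (r : ↥U).2.2
    have hr0 : (((r : ↥U) : Kˣ) : K) ≠ 0 := ((r : ↥U) : Kˣ).ne_zero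
    have hid : f - φ r = (c * (((r : ↥U) : Kˣ) : K)) * (((((r : ↥U) : Kˣ) : K))⁻¹ * (f / c) - 1) := by
      simp only [φ]
      field_simp
    rw [hid, map_mul, map_mul, hvc, hvr, mul_one, pow_add, mul_comm (Valued.v ϖ ^ ρ), v_pow_eq_exp_neg hϖ ρ]
    exact mul_le_mul' le_rfl hr'
  · -- (R3) irredundance
    rintro g ⟨s, hs, rfl⟩ g' ⟨s', hs', rfl⟩ hgg
    simp only [φ] at hgg
    have hvs : Valued.v ((((s : ↥U) : Kˣ) : K)) = 1 := s.2.2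
    have hs0 : (((s : ↥U) : Kˣ) : K) ≠ 0 := ((s : ↥U) : Kˣ).ne_zero
    -- `|s⁻¹ s′ − 1| ≤ exp(−ρ)`
    have hlev : Valued.v (((((s : ↥U) : Kˣ) : K))⁻¹ * (((s' : ↥U) : Kˣ) : K) - 1) ≤ exp (-(ρ : ℤ)) := by
      have hid : ((((s : ↥U) : Kˣ) : K))⁻¹ * (((s' : ↥U) : Kˣ) : K) - 1 = ((((s : ↥U) : Kˣ) : K))⁻¹ * c⁻¹ * (-(c * (((s : ↥U) : Kˣ) : K) - c * (((s' : ↥U) : Kˣ) : K))) := by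
        field_simp
        ring
      rw [hid, map_mul, map_mul, map_inv₀, map_inv₀, hvs, hvc, inv_one, one_mul, Valuation.map_neg, ← v_pow_eq_exp_neg hϖ ρ]
      have hpos : (0 : ℤᵐ⁰) < Valued.v ϖ ^ (2 * t) := pow_pos ((Valuation.pos_iff _).2 hϖ0) _
      rw [pow_add, mul_comm (Valued.v ϖ ^ ρ)] at hgg
      calc (Valued.v ϖ ^ (2 * t))⁻¹ * Valued.v (c * (((s : ↥U) : Kˣ) : K) - c * (((s' : ↥U) : Kˣ) : K))
          ≤ (Valued.v ϖ ^ (2 * t))⁻¹ * (Valued.v ϖ ^ (2 * t) * Valued.v ϖ ^ ρ) := mul_le_mul' le_rfl hgg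
        _ = Valued.v ϖ ^ ρ := by rw [← mul_assoc, inv_mul_cancel₀ hpos.ne', one_mul]
    -- hence `s⁻¹ s′ ∈ U_{F,ρ}`
    have hmem : ((⟨s, hs⟩ : S) : ↥U)⁻¹ * s' ∈ (Uρ.subgroupOf U : Set ↥U) := by
      rw [SetLike.mem_coe, Subgroup.mem_subgroupOf, hUρ]
      have hfix := (hU _).1 (U.mul_mem (U.inv_mem s.2) s'.2)
      have hval : ((((s : ↥U)⁻¹ * s' : ↥U) : Kˣ) : K) = ((((s : ↥U) : Kˣ) : K))⁻¹ * (((s' : ↥U) : Kˣ) : K) := by simp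
      refine ⟨⟨?_, ?_⟩, ?_⟩
      · rw [hval, map_mul, map_inv₀, s.2.1, s'.2.1]
      · rw [hval, map_mul, map_inv₀, hvs, s'.2.2, inv_one, one_mul]
      · rw [hval]; exact hlev
    -- uniqueness of the representative of the coset of `s′`
    obtain ⟨r, -, hr⟩ := (Subgroup.isComplement_iff_existsUnique_inv_mul_mem.1 hS) (s' : ↥U)
    have h1 : (⟨s, hs⟩ : S) = r := hr ⟨s, hs⟩ hmem
    have h2 : (⟨s', hs'⟩ : S) = r := hr ⟨s', hs'⟩ (by simp only [inv_mul_cancel, SetLike.mem_coe]; exact (Uρ.subgroupOf U).one_mem)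
    have hss : s = s' := by
      have := congrArg (fun z : S => (z : ↥U)) (h1.trans h2.symm)
      simpa using this
    rw [hss]

end Summit.HodgeConjecture.HodgeConjecture.Cruxes.H413.F0P3cDyRamDiagonalGluedClassRepresentatives

end
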